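import Literature.Analysis.Calculus.WallClassEmbedding
import Literature.Analysis.Calculus.RegularClassEmbedding

/-!
# Smooth germs at a torus point, symmetric under its stabiliser, factor through the complex class data

The three local models — corner ★ `exists_contDiffOn_comp_cornerClass_of_forall_perm` (stabiliser `S₃`), wall
★ `exists_contDiffOn_comp_wallClass_of_swap` (stabiliser `S₂`) and regular ★ `exists_contDiffOn_comp_regularClass`
(trivial stabiliser) — assembled at an ARBITRARY base point `b = (b₀, b₁, b₂) ∈ ℝ³`: if a smooth germ
`g : (Fin 3 → ℝ) × P → E` is invariant under every permutation `σ` of the slots fixing the eigenvalue triple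
`(e^{ib_k})_k`, then `g (x, z) = F (S_b x, z)` for `‖x‖ < δ` with `F` smooth on `W × P`, `W ∋ S_b 0` open,
`S_b(x) = (Σ λ_k, Σ_{j<k} λ_jλ_k, Π λ_k)`, `λ_k = e^{i(b_k + x_k)}`.

The reduction to the three normal forms is a transport along a slot permutation `τ` and a `2π`-renormalisation of
the base angles (`S_b` only sees `e^{ib_k}`).  This is the local form, at one place, of Glaeser's theorem for the
Weyl group of `U(3)` [Glaeser1963Newton, Thm. II], [Schwarz1975, Thm. 1].
-/

noncomputable section

open Complex Set
open scoped ContDiff Topology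

namespace Literature.Analysis.Calculus

/-! ## §1 Helpers: sup norm and symmetric data under slot permutations -/

/-- The sup norm is invariant under permutation of the coordinates. [cite: Dieudonne1960, Ch. V §1] -/
theorem norm_comp_perm {ι : Type*} [Fintype ι] (x : ι → ℝ) (σ : Equiv.Perm ι) : ‖x ∘ σ‖ = ‖x‖ := by
  refine le_antisymm ((pi_norm_le_iff_of_nonneg (norm_nonneg _)).2 fun i => norm_le_pi_norm x (σ i))
    ((pi_norm_le_iff_of_nonneg (norm_nonneg _)).2 fun i => ?_)
  have h := norm_le_pi_norm (x ∘ σ) (σ.symm i)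
  simpa using h

/-- `e^{ia} = e^{ia'} ⇒ e^{i(a+x)} = e^{i(a'+x)}`. [cite: Dieudonne1960, Ch. IX §5] -/
theorem cexp_add_mul_I_congr {a a' : ℝ} (h : Complex.exp ((a : ℂ) * I) = Complex.exp ((a' : ℂ) * I)) (x : ℝ) :
    Complex.exp ((((a + x : ℝ)) : ℂ) * I) = Complex.exp ((((a' + x : ℝ)) : ℂ) * I) := by
  rw [cexp_add_mul_I, cexp_add_mul_I, h]

/-- The elementary symmetric data of a permuted triple. [cite: Glaeser1963Newton, §1] -/
theorem esymmTriple_comp_perm (l : Fin 3 → ℂ) (σ : Equiv.Perm (Fin 3)) :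
    ((l (σ 0) + l (σ 1) + l (σ 2), l (σ 0) * l (σ 1) + l (σ 0) * l (σ 2) + l (σ 1) * l (σ 2), l (σ 0) * l (σ 1) * l (σ 2)) : ℂ × ℂ × ℂ) =
      (l 0 + l 1 + l 2, l 0 * l 1 + l 0 * l 2 + l 1 * l 2, l 0 * l 1 * l 2) := by
  have h1 : ∑ i, l (σ i) = ∑ i, l i := Equiv.sum_comp σ l
  have h2 : ∑ i, l (σ i) ^ 2 = ∑ i, l i ^ 2 := Equiv.sum_comp σ (fun i => l i ^ 2)
  have h3 : ∏ i, l (σ i) = ∏ i, l i := Equiv.prod_comp σ l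
  simp only [Fin.sum_univ_three, Fin.prod_univ_three] at h1 h2 h3
  have h2' : l (σ 0) * l (σ 1) + l (σ 0) * l (σ 2) + l (σ 1) * l (σ 2) = l 0 * l 1 + l 0 * l 2 + l 1 * l 2 := by
    linear_combination (1 / 2 : ℂ) * (l (σ 0) + l (σ 1) + l (σ 2) + (l 0 + l 1 + l 2)) * h1 - (1 / 2 : ℂ) * h2
  rw [h1, h2', h3]

/-! ## §2 Transport of the local factorisation along a slot permutation and a `2π`-renormalisation -/

universe u

variable {P : Type u} [NormedAddCommGroup P] [NormedSpace ℝ P] {E : Type u} [NormedAddCommGroup E] [NormedSpace ℝ E]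

/-- **TRANSPORT.**  If `e^{ib'_k} = e^{ib_{τ k}}` and `g' (y, z) = g (y ∘ τ⁻¹, z)`, a local factorisation of `g'` through `S_{b'}` is a local factorisation of `g`
through `S_b` (same `W`, `F`, `δ`; substitute `y := x ∘ τ`, `S_{b'} (x ∘ τ) = S_b x`). [cite: Glaeser1963Newton, §1] -/
theorem exists_contDiffOn_comp_class_transport (b b' : Fin 3 → ℝ) (τ : Equiv.Perm (Fin 3))
    (hb : ∀ k, Complex.exp ((b' k : ℂ) * I) = Complex.exp ((b (τ k) : ℂ) * I)) (g g' : (Fin 3 → ℝ) × P → E)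
    (hg : ∀ (y : Fin 3 → ℝ) (z : P), g' (y, z) = g (y ∘ (⇑τ.symm), z))
    (h : ∃ W : Set (ℂ × ℂ × ℂ), IsOpen W ∧ ∃ F : (ℂ × ℂ × ℂ) × P → E, ContDiffOn ℝ ∞ F (W ×ˢ Set.univ) ∧
      ∃ δ > (0 : ℝ), ∀ y : Fin 3 → ℝ, ‖y‖ < δ → ∀ z : P, ((Complex.exp ((((b' 0 + y 0 : ℝ)) : ℂ) * I) + Complex.exp ((((b' 1 + y 1 : ℝ)) : ℂ) * I) + Complex.exp ((((b' 2 + y 2 : ℝ)) : ℂ) * I),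
          Complex.exp ((((b' 0 + y 0 : ℝ)) : ℂ) * I) * Complex.exp ((((b' 1 + y 1 : ℝ)) : ℂ) * I) + Complex.exp ((((b' 0 + y 0 : ℝ)) : ℂ) * I) * Complex.exp ((((b' 2 + y 2 : ℝ)) : ℂ) * I) + Complex.exp ((((b' 1 + y 1 : ℝ)) : ℂ) * I) * Complex.exp ((((b' 2 + y 2 : ℝ)) : ℂ) * I),
          Complex.exp ((((b' 0 + y 0 : ℝ)) : ℂ) * I) * Complex.exp ((((b' 1 + y 1 : ℝ)) : ℂ) * I) * Complex.exp ((((b' 2 + y 2 : ℝ)) : ℂ) * I)) : ℂ × ℂ × ℂ) ∈ W ∧ F (((Complex.exp ((((b' 0 + y 0 : ℝ)) : ℂ) * I) + Complex.exp ((((b' 1 + y 1 : ℝ)) : ℂ) * I) + Complex.exp ((((b' 2 + y 2 : ℝ)) : ℂ) * I),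
          Complex.exp ((((b' 0 + y 0 : ℝ)) : ℂ) * I) * Complex.exp ((((b' 1 + y 1 : ℝ)) : ℂ) * I) + Complex.exp ((((b' 0 + y 0 : ℝ)) : ℂ) * I) * Complex.exp ((((b' 2 + y 2 : ℝ)) : ℂ) * I) + Complex.exp ((((b' 1 + y 1 : ℝ)) : ℂ) * I) * Complex.exp ((((b' 2 + y 2 : ℝ)) : ℂ) * I),
          Complex.exp ((((b' 0 + y 0 : ℝ)) : ℂ) * I) * Complex.exp ((((b' 1 + y 1 : ℝ)) : ℂ) * I) * Complex.exp ((((b' 2 + y 2 : ℝ)) : ℂ) * I)) : ℂ × ℂ × ℂ), z) = g' (y, z)) :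
    ∃ W : Set (ℂ × ℂ × ℂ), IsOpen W ∧ ∃ F : (ℂ × ℂ × ℂ) × P → E, ContDiffOn ℝ ∞ F (W ×ˢ Set.univ) ∧
      ∃ δ > (0 : ℝ), ∀ x : Fin 3 → ℝ, ‖x‖ < δ → ∀ z : P, ((Complex.exp ((((b 0 + x 0 : ℝ)) : ℂ) * I) + Complex.exp ((((b 1 + x 1 : ℝ)) : ℂ) * I) + Complex.exp ((((b 2 + x 2 : ℝ)) : ℂ) * I),
          Complex.exp ((((b 0 + x 0 : ℝ)) : ℂ) * I) * Complex.exp ((((b 1 + x 1 : ℝ)) : ℂ) * I) + Complex.exp ((((b 0 + x 0 : ℝ)) : ℂ) * I) * Complex.exp ((((b 2 + x 2 : ℝ)) : ℂ) * I) + Complex.exp ((((b 1 + x 1 : ℝ)) : ℂ) * I) * Complex.exp ((((b 2 + x 2 : ℝ)) : ℂ) * I),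
          Complex.exp ((((b 0 + x 0 : ℝ)) : ℂ) * I) * Complex.exp ((((b 1 + x 1 : ℝ)) : ℂ) * I) * Complex.exp ((((b 2 + x 2 : ℝ)) : ℂ) * I)) : ℂ × ℂ × ℂ) ∈ W ∧ F (((Complex.exp ((((b 0 + x 0 : ℝ)) : ℂ) * I) + Complex.exp ((((b 1 + x 1 : ℝ)) : ℂ) * I) + Complex.exp ((((b 2 + x 2 : ℝ)) : ℂ) * I),
          Complex.exp ((((b 0 + x 0 : ℝ)) : ℂ) * I) * Complex.exp ((((b 1 + x 1 : ℝ)) : ℂ) * I) + Complex.exp ((((b 0 + x 0 : ℝ)) : ℂ) * I) * Complex.exp ((((b 2 + x 2 : ℝ)) : ℂ) * I) + Complex.exp ((((b 1 + x 1 : ℝ)) : ℂ) * I) * Complex.exp ((((b 2 + x 2 : ℝ)) : ℂ) * I),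
          Complex.exp ((((b 0 + x 0 : ℝ)) : ℂ) * I) * Complex.exp ((((b 1 + x 1 : ℝ)) : ℂ) * I) * Complex.exp ((((b 2 + x 2 : ℝ)) : ℂ) * I)) : ℂ × ℂ × ℂ), z) = g (x, z) := by
  obtain ⟨W, hWo, F, hF, δ, hδ, h⟩ := h
  refine ⟨W, hWo, F, hF, δ, hδ, fun x hx z => ?_⟩
  have hy : ‖x ∘ (⇑τ)‖ < δ := by rwa [norm_comp_perm]
  obtain ⟨h1, h2⟩ := h (x ∘ (⇑τ)) hy z
  set l : Fin 3 → ℂ := fun k => Complex.exp ((((b k + x k : ℝ)) : ℂ) * I) with hl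
  have hk : ∀ k, Complex.exp ((((b' k + (x ∘ (⇑τ)) k : ℝ)) : ℂ) * I) = l (τ k) := by
    intro k
    simp only [hl, Function.comp_apply]
    exact cexp_add_mul_I_congr (hb k) _
  have hS : ((Complex.exp ((((b' 0 + (x ∘ (⇑τ)) 0 : ℝ)) : ℂ) * I) + Complex.exp ((((b' 1 + (x ∘ (⇑τ)) 1 : ℝ)) : ℂ) * I) +
        Complex.exp ((((b' 2 + (x ∘ (⇑τ)) 2 : ℝ)) : ℂ) * I),
      Complex.exp ((((b' 0 + (x ∘ (⇑τ)) 0 : ℝ)) : ℂ) * I) * Complex.exp ((((b' 1 + (x ∘ (⇑τ)) 1 : ℝ)) : ℂ) * I) +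
        Complex.exp ((((b' 0 + (x ∘ (⇑τ)) 0 : ℝ)) : ℂ) * I) * Complex.exp ((((b' 2 + (x ∘ (⇑τ)) 2 : ℝ)) : ℂ) * I) +
        Complex.exp ((((b' 1 + (x ∘ (⇑τ)) 1 : ℝ)) : ℂ) * I) * Complex.exp ((((b' 2 + (x ∘ (⇑τ)) 2 : ℝ)) : ℂ) * I),
      Complex.exp ((((b' 0 + (x ∘ (⇑τ)) 0 : ℝ)) : ℂ) * I) * Complex.exp ((((b' 1 + (x ∘ (⇑τ)) 1 : ℝ)) : ℂ) * I) *
        Complex.exp ((((b' 2 + (x ∘ (⇑τ)) 2 : ℝ)) : ℂ) * I)) : ℂ × ℂ × ℂ) = (l 0 + l 1 + l 2, l 0 * l 1 + l 0 * l 2 + l 1 * l 2, l 0 * l 1 * l 2) := by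
    rw [hk 0, hk 1, hk 2]
    exact esymmTriple_comp_perm l τ
  rw [hS] at h1
  rw [hS, hg] at h2
  have hxx : (x ∘ (⇑τ)) ∘ (⇑τ.symm) = x := by
    funext k; simp
  rw [hxx] at h2
  exact ⟨h1, h2⟩

/-! ## §3 The local model at an arbitrary base point -/

/-- **SMOOTH GERMS SYMMETRIC UNDER THE STABILISER FACTOR THROUGH THE CLASS DATA — ARBITRARY BASE POINT.**  For `b ∈ ℝ³` and a `C^∞` germ
`g : (Fin 3 → ℝ) × P → E` with `g (x ∘ σ, z) = g (x, z)` for every slot permutation `σ` fixing `(e^{ib_k})_k`, there are an open `W ⊆ ℂ³`, `F` smooth on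
`W × P` and `δ > 0` with `S_b x ∈ W` and **`F (S_b x, z) = g (x, z)` for `‖x‖ < δ`** (`S_b(x) = (Σ λ_k, Σ_{j<k} λ_jλ_k, Π λ_k)`, `λ_k = e^{i(b_k + x_k)}`;
`P` finite-dimensional, `E` complete, one universe).  Cases: corner ★ (`S₃`), wall ★ (`S₂`, three slot patterns, transported by ★
`exists_contDiffOn_comp_class_transport`), regular ★. [cite: Glaeser1963Newton, Thm. II] [cite: Schwarz1975, Thm. 1] [cite: Dieudonne1960, Ch. X §2] -/
theorem exists_contDiffOn_comp_class_of_stabilizer [FiniteDimensional ℝ P] [CompleteSpace E] (b : Fin 3 → ℝ) (g : (Fin 3 → ℝ) × P → E)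
    (hg : ContDiff ℝ ∞ g)
    (hstab : ∀ σ : Equiv.Perm (Fin 3), (∀ k, Complex.exp ((b (σ k) : ℂ) * I) = Complex.exp ((b k : ℂ) * I)) →
      ∀ (x : Fin 3 → ℝ) (z : P), g (x ∘ (⇑σ), z) = g (x, z)) :
    ∃ W : Set (ℂ × ℂ × ℂ), IsOpen W ∧ ∃ F : (ℂ × ℂ × ℂ) × P → E, ContDiffOn ℝ ∞ F (W ×ˢ Set.univ) ∧
      ∃ δ > (0 : ℝ), ∀ x : Fin 3 → ℝ, ‖x‖ < δ → ∀ z : P, ((Complex.exp ((((b 0 + x 0 : ℝ)) : ℂ) * I) + Complex.exp ((((b 1 + x 1 : ℝ)) : ℂ) * I) + Complex.exp ((((b 2 + x 2 : ℝ)) : ℂ) * I),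
          Complex.exp ((((b 0 + x 0 : ℝ)) : ℂ) * I) * Complex.exp ((((b 1 + x 1 : ℝ)) : ℂ) * I) + Complex.exp ((((b 0 + x 0 : ℝ)) : ℂ) * I) * Complex.exp ((((b 2 + x 2 : ℝ)) : ℂ) * I) + Complex.exp ((((b 1 + x 1 : ℝ)) : ℂ) * I) * Complex.exp ((((b 2 + x 2 : ℝ)) : ℂ) * I),
          Complex.exp ((((b 0 + x 0 : ℝ)) : ℂ) * I) * Complex.exp ((((b 1 + x 1 : ℝ)) : ℂ) * I) * Complex.exp ((((b 2 + x 2 : ℝ)) : ℂ) * I)) : ℂ × ℂ × ℂ) ∈ W ∧ F (((Complex.exp ((((b 0 + x 0 : ℝ)) : ℂ) * I) + Complex.exp ((((b 1 + x 1 : ℝ)) : ℂ) * I) + Complex.exp ((((b 2 + x 2 : ℝ)) : ℂ) * I),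
          Complex.exp ((((b 0 + x 0 : ℝ)) : ℂ) * I) * Complex.exp ((((b 1 + x 1 : ℝ)) : ℂ) * I) + Complex.exp ((((b 0 + x 0 : ℝ)) : ℂ) * I) * Complex.exp ((((b 2 + x 2 : ℝ)) : ℂ) * I) + Complex.exp ((((b 1 + x 1 : ℝ)) : ℂ) * I) * Complex.exp ((((b 2 + x 2 : ℝ)) : ℂ) * I),
          Complex.exp ((((b 0 + x 0 : ℝ)) : ℂ) * I) * Complex.exp ((((b 1 + x 1 : ℝ)) : ℂ) * I) * Complex.exp ((((b 2 + x 2 : ℝ)) : ℂ) * I)) : ℂ × ℂ × ℂ), z) = g (x, z) := by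
  set Λ : Fin 3 → ℂ := fun k => Complex.exp ((b k : ℂ) * I) with hΛ
  by_cases h01 : Λ 0 = Λ 1
  · by_cases h02 : Λ 0 = Λ 2
    · -- CORNER: all three eigenvalues coincide; every `σ` stabilises
      have hsymm : ∀ (σ : Equiv.Perm (Fin 3)) (x : Fin 3 → ℝ) (z : P), g (x ∘ (⇑σ), z) = g (x, z) := by
        intro σ
        refine hstab σ fun k => ?_
        have hall : ∀ j, Λ j = Λ 0 := by intro j; fin_cases j <;> [rfl; exact h01.symm; exact h02.symm]
        show Λ (σ k) = Λ k
        rw [hall (σ k), hall k]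
      obtain ⟨W, hWo, -, F, hF, δ, hδ, h⟩ := exists_contDiffOn_comp_cornerClass_of_forall_perm (b 0) g hg hsymm
      refine exists_contDiffOn_comp_class_transport b ![b 0, b 0, b 0] (Equiv.refl _) (fun k => ?_) g g (fun y z => by simp)
        ⟨W, hWo, F, hF, δ, hδ, fun y hy z => by simpa using h y hy z⟩
      fin_cases k
      · simp
      · simpa using h01
      · simpa using h02
    · -- WALL, equal pair in slots `0, 1`
      have hswap : ∀ (x : Fin 3 → ℝ) (z : P), g (x ∘ (⇑(Equiv.swap (0 : Fin 3) 1)), z) = g (x, z) := by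
        refine hstab _ fun k => ?_
        show Λ (Equiv.swap (0 : Fin 3) 1 k) = Λ k
        fin_cases k
        · simpa using h01.symm
        · simpa using h01
        · simp [Equiv.swap_apply_of_ne_of_ne]
      obtain ⟨W, hWo, -, F, hF, δ, hδ, h⟩ := exists_contDiffOn_comp_wallClass_of_swap (b 0) (b 2) h02 g hg hswap
      refine exists_contDiffOn_comp_class_transport b ![b 0, b 0, b 2] (Equiv.refl _) (fun k => ?_) g g (fun y z => by simp)
        ⟨W, hWo, F, hF, δ, hδ, fun y hy z => by simpa using h y hy z⟩
      fin_cases k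
      · simp
      · simpa using h01
      · simp
  · by_cases h02 : Λ 0 = Λ 2
    · -- WALL, equal pair in slots `0, 2`: transport along `τ = swap 1 2`
      set g' : (Fin 3 → ℝ) × P → E := fun q => g (q.1 ∘ (⇑(Equiv.swap (1 : Fin 3) 2)), q.2) with hg'
      have hg's : ContDiff ℝ ∞ g' := by
        refine hg.comp (ContDiff.prodMk ?_ contDiff_snd)
        exact contDiff_pi.2 fun k => (contDiff_apply ℝ ℝ ((Equiv.swap (1 : Fin 3) 2) k)).comp contDiff_fst
      have hswap : ∀ (x : Fin 3 → ℝ) (z : P), g' (x ∘ (⇑(Equiv.swap (0 : Fin 3) 1)), z) = g' (x, z) := by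
        intro x z
        have hst := hstab (Equiv.swap (0 : Fin 3) 2) (fun k => by
          show Λ (Equiv.swap (0 : Fin 3) 2 k) = Λ k
          fin_cases k
          · simpa using h02.symm
          · simp [Equiv.swap_apply_of_ne_of_ne]
          · simpa using h02) (x ∘ (⇑(Equiv.swap (1 : Fin 3) 2))) z
        have hfun : (x ∘ (⇑(Equiv.swap (0 : Fin 3) 1))) ∘ (⇑(Equiv.swap (1 : Fin 3) 2)) =
            (x ∘ (⇑(Equiv.swap (1 : Fin 3) 2))) ∘ (⇑(Equiv.swap (0 : Fin 3) 2)) := by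
          funext k; fin_cases k <;> simp [Equiv.swap_apply_of_ne_of_ne]
        simp only [hg']
        rw [hfun, hst]
      obtain ⟨W, hWo, -, F, hF, δ, hδ, h⟩ := exists_contDiffOn_comp_wallClass_of_swap (b 0) (b 1) h01 g' hg's hswap
      refine exists_contDiffOn_comp_class_transport b ![b 0, b 0, b 1] (Equiv.swap (1 : Fin 3) 2) (fun k => ?_) g g'
        (fun y z => by simp [hg', Equiv.symm_swap]) ⟨W, hWo, F, hF, δ, hδ, fun y hy z => by simpa using h y hy z⟩
      fin_cases k
      · simp [Equiv.swap_apply_of_ne_of_ne]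
      · simpa using h02
      · simp
    · by_cases h12 : Λ 1 = Λ 2
      · -- WALL, equal pair in slots `1, 2`: transport along `τ = swap 0 2`
        set g' : (Fin 3 → ℝ) × P → E := fun q => g (q.1 ∘ (⇑(Equiv.swap (0 : Fin 3) 2)), q.2) with hg'
        have hg's : ContDiff ℝ ∞ g' := by
          refine hg.comp (ContDiff.prodMk ?_ contDiff_snd)
          exact contDiff_pi.2 fun k => (contDiff_apply ℝ ℝ ((Equiv.swap (0 : Fin 3) 2) k)).comp contDiff_fst
        have hswap : ∀ (x : Fin 3 → ℝ) (z : P), g' (x ∘ (⇑(Equiv.swap (0 : Fin 3) 1)), z) = g' (x, z) := by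
          intro x z
          have hst := hstab (Equiv.swap (1 : Fin 3) 2) (fun k => by
            show Λ (Equiv.swap (1 : Fin 3) 2 k) = Λ k
            fin_cases k
            · simp [Equiv.swap_apply_of_ne_of_ne]
            · simpa using h12.symm
            · simpa using h12) (x ∘ (⇑(Equiv.swap (0 : Fin 3) 2))) z
          have hfun : (x ∘ (⇑(Equiv.swap (0 : Fin 3) 1))) ∘ (⇑(Equiv.swap (0 : Fin 3) 2)) =
              (x ∘ (⇑(Equiv.swap (0 : Fin 3) 2))) ∘ (⇑(Equiv.swap (1 : Fin 3) 2)) := by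
            funext k; fin_cases k <;> simp [Equiv.swap_apply_of_ne_of_ne]
          simp only [hg']
          rw [hfun, hst]
        obtain ⟨W, hWo, -, F, hF, δ, hδ, h⟩ := exists_contDiffOn_comp_wallClass_of_swap (b 1) (b 0) (Ne.symm h01) g' hg's hswap
        refine exists_contDiffOn_comp_class_transport b ![b 1, b 1, b 0] (Equiv.swap (0 : Fin 3) 2) (fun k => ?_) g g'
          (fun y z => by simp [hg', Equiv.symm_swap]) ⟨W, hWo, F, hF, δ, hδ, fun y hy z => by simpa using h y hy z⟩
        fin_cases k
        · simpa using h12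
        · simp [Equiv.swap_apply_of_ne_of_ne]
        · simp
      · -- REGULAR
        have hb : ∀ j k : Fin 3, j ≠ k → Complex.exp ((b j : ℂ) * I) ≠ Complex.exp ((b k : ℂ) * I) := by
          intro j k hjk
          fin_cases j <;> fin_cases k
          all_goals first | exact absurd rfl hjk | skip
          · exact h01
          · exact h02
          · exact Ne.symm h01
          · exact h12
          · exact Ne.symm h02
          · exact Ne.symm h12
        exact exists_contDiffOn_comp_regularClass b hb g hg

end Literature.Analysis.Calculus

end
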